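/-
Copyright (c) 2026 the pub-hodgecm-mathlib formalisation cell (harness21).  Prover seat hodgecm-mathlib-K2Liu-p09 (g5): Track B «K2-LIT»,
hLiu418 = stmt-HodgeConjecture-24832; LEAD F0P6-plan RULINGS M-156m∕o, M-157a∕c «A7 = GK COCYCLE ROAD», file B4d-3.
-/
import Summits.HodgeConjecture.HodgeConjecture.Theorems.K2LiuDoubledUTwoTwoUnipotentHaar      -- ★ B1b-2b (p03): `exists_homeomorph_coordTwo`, `isAddHaarMeasure_map_symm`
import Summits.HodgeConjecture.HodgeConjecture.Theorems.K2LiuIteratedRankOneCocycle         -- ★ B4-abs: `integral_comp_eq_iterated(_of_chain)`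
import Literature.NumberTheory.K2Lit.LocalSiegelIntertwining                                -- ★ D10 `localIntertwining`, `IsLocalSiegelSection`
import Mathlib.MeasureTheory.Measure.Haar.Unique
import HarnessLib

/-!
# Crux `HLiu418`, road `K2_Liu`, organ A7-reg (GK cocycle road), file B4d-3:
# THE SIEGEL INTERTWINING INTEGRAL OF `H_v = U(2,2)(F_v)` AS AN ITERATED RANK-ONE INTEGRAL — the cocycle `M = A₂ A₁ A₂` instantiated

Cell `hodgecm-mathlib`, crux item hLiu418 = `stmt-HodgeConjecture-24832`; squad K2 ∕ K2Liu; prover K2Liu-p09 (g5).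
THEOREMS ONLY (no `def`, no instance, no notation, no named-fact hypothesis, no `sorry`); lane `--supports stmt-HodgeConjecture-24832`
(count-neutral helper).  ONE FRAME (RULING M-156o (c)) — K2Liu-p03 (g6)'s ★ letters and transport; ★ B4-abs (mine) does the measure theory.

* §1 `w_Δ = m₀ · φ(w_Δ^J)` with `m₀ = w_Δ φ(w_Δ^J) ∈ P_Δ(F_v)` (★ `isSiegelDelta_weylDelta_mul_frameConj_weylSiegel`, `(w_Δ^J)² = 1`), so for a Siegel section
  `∫ f(w_Δ u h) = χ_s(m₀) · ∫ f(φ(w_Δ^J) u h)` (`localIntertwining_eq_mul_integral_frameConj`).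
* §2 the Haar measure of `N_Δ(F_v)` through the coordinates `e : F_v × (E ⊗ F_v) × F_v ≃ₜ N_Δ(F_v)` of ★ B1b-2b is a positive multiple of the pushed
  product measure: `νN = c • map e (μ_F ⊗ μ_R ⊗ μ_F)` for some `c > 0` (`exists_measure_eq_smul_map`; `c` is then a FIXED input of §3).
* §3 **`integral_frameConj_weylSiegel_eq_iterated`**: for `f`, `h` with the triple integrand integrable on the product,
  `∫_{N_Δ} f(φ(w_Δ^J) u h) dνN(u) = c · ∫_x ∫_z ∫_y f(φ(w₂)φ(u_{2e₂}(ι_v(y)δ)) · (φ(w₁)φ(u_{e₁−e₂}(z)) · (φ(w₂)φ(u_{2e₂}(ι_v(x)δ)) · h)))`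
  (★ B4-abs `integral_comp_eq_iterated` with the word ★ `weylSiegel_mul_nSiegel` through `φ`), and `…_of_chain` taking the three `|f|`-chain
  integrabilities instead (★ B4-abs `integral_comp_eq_iterated_of_chain`).
HONEST LABEL.  `HC_CM` is proved only modulo the 7 printed citations (2 remaining named inputs: hLiu418 = `stmt-HodgeConjecture-24832`,
h413 = `stmt-HodgeConjecture-24833`) until rung 0 closes.

## References
* [Casselman1980] W. Casselman, Compositio Math. 40 (1980), §3 Thm. 3.1 (the cocycle along `s₂ s₁ s₂`).
* [HarrisKudlaSweet1996] M. Harris, S. Kudla, W. J. Sweet, J. AMS 9 (1996), §1 (1.11)–(1.12), §6 (6.14).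
* [Weil1965] A. Weil, Acta Math. 113 (1965), §37 (Haar measures in coordinates).
-/

set_option autoImplicit false
set_option linter.dupNamespace false -- the mandated namespace repeats `HodgeConjecture.HodgeConjecture`

noncomputable section

open NumberField IsDedekindDomain Matrix MeasureTheory
open scoped NNReal ENNReal
open Literature.NumberTheory.Automorphic Literature.NumberTheory.Automorphic.UnitaryGroup
open Literature.NumberTheory.GelbartRogawski1991.AdaptedBlocks
open Literature.NumberTheory.GelbartRogawski1991.UnitaryDualPair.LocalSplitting
open Literature.NumberTheory.K2Lit.LocalSiegelDoubled
open Summit.HodgeConjecture.HodgeConjecture.Cruxes.HLiu418.K2LiuLocalSiegelIwasawaFrame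
open Summit.HodgeConjecture.HodgeConjecture.Cruxes.HLiu418.K2LiuLocalSiegelIwasawa
open Summit.HodgeConjecture.HodgeConjecture.Cruxes.HLiu418.K2LiuDoubledUTwoTwoBorelFrame
open Summit.HodgeConjecture.HodgeConjecture.Cruxes.HLiu418.K2LiuDoubledUTwoTwoWeylCocycle
open Summit.HodgeConjecture.HodgeConjecture.Cruxes.HLiu418.K2LiuDoubledUTwoTwoFrameTransport
open Summit.HodgeConjecture.HodgeConjecture.Cruxes.HLiu418.K2LiuDoubledUTwoTwoUnipotentCoordinates
open Summit.HodgeConjecture.HodgeConjecture.Cruxes.HLiu418.K2LiuDoubledUTwoTwoUnipotentHaar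
open Summit.HodgeConjecture.HodgeConjecture.Cruxes.HLiu418.K2LiuUnipDeltaRankOneCoordinates
open Summit.HodgeConjecture.HodgeConjecture.Cruxes.HLiu418.K2LiuIteratedRankOneCocycle

namespace Summit.HodgeConjecture.HodgeConjecture.Cruxes.HLiu418.K2LiuSiegelIntertwiningCocycle

variable (F : Type) [Field F] [NumberField F] (E : Type) [Field E] [NumberField E] [Algebra F E]
  [Algebra.IsQuadraticExtension F E] (c : E ≃ₐ[F] E)
  {δ : E} (hcδ : c δ = -δ) (hδ : δ ≠ 0) {d : F} (hd : δ * δ = algebraMap F E d) (v : HeightOneSpectrum (𝓞 F))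
  {T₂ : Matrix (Fin 2) (Fin 2) F} (hT₂ : T₂.IsSymm) {J₂D : Matrix (Fin (2 + 2)) (Fin (2 + 2)) E} (hJ₂D : J₂D = (gramD F 2 T₂).map (algebraMap F E))
  (D Dinv : Matrix (Fin 2) (Fin 2) F) (hDD : D * Dinv = 1) (hDD' : Dinv * D = 1) (Q : GL (Fin (2 + 2)) F)
  (hQm : (Q : Matrix (Fin (2 + 2)) (Fin (2 + 2)) F) = Matrix.reindex (e₂ 2) (e₂ 2) (Matrix.fromBlocks 1 D 1 (-D)))
  (hQ : (Q : Matrix (Fin (2 + 2)) (Fin (2 + 2)) F)ᵀ * gramD F 2 T₂ * (Q : Matrix (Fin (2 + 2)) (Fin (2 + 2)) F) = (StdForm.antidiagonal (2 + 2)).over F)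

/-! ## §1 `w_Δ = m₀ · φ(w_Δ^J)` and the Levi shift out of the intertwining integral -/

/-- `(w_Δ^J)² = 1` in `U(J₄)`. [cite: HarrisKudlaSweet1996, §1 (1.12)] -/
theorem weylSiegel_mul_weylSiegel {R' : Type*} [CommRing R'] (σ' : R' →+* R') : weylSiegel R' σ' * weylSiegel R' σ' = 1 := by
  rw [weylSiegel, show weylTwo R' σ' * weylOne R' σ' * weylTwo R' σ' * (weylTwo R' σ' * weylOne R' σ' * weylTwo R' σ') =
      weylTwo R' σ' * weylOne R' σ' * (weylTwo R' σ' * weylTwo R' σ') * weylOne R' σ' * weylTwo R' σ' by group,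
    weylTwo_mul_weylTwo, mul_one, mul_assoc (weylTwo R' σ'), weylOne_mul_weylOne, mul_one, weylTwo_mul_weylTwo]

omit [Algebra.IsQuadraticExtension F E] in
/-- **`w_Δ = m₀ · φ(w_Δ^J)`** with `m₀ := w_Δ · φ(w_Δ^J)` (`φ(w_Δ^J)² = 1`). [cite: HarrisKudlaSweet1996, §1 (1.12)] -/
theorem weylDelta_eq_mul_frameConj_weylSiegel :
    weylDelta F E c v 2 hJ₂D (T₀ := T₂) =
      (weylDelta F E c v 2 hJ₂D (T₀ := T₂) * FrameTransport.frameConj F E c v (2 + 2) hJ₂D (antidiagonal_over_eq_map F E 2) Q hQ (toLocalFour F E c v (weylSiegel (UnitaryGroup.LocalRing E v) (UnitaryGroup.conjLocal E c v)))) * FrameTransport.frameConj F E c v (2 + 2) hJ₂D (antidiagonal_over_eq_map F E 2) Q hQ (toLocalFour F E c v (weylSiegel (UnitaryGroup.LocalRing E v) (UnitaryGroup.conjLocal E c v))) := by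
  rw [mul_assoc, ← map_mul, ← map_mul, weylSiegel_mul_weylSiegel, map_one, map_one, mul_one]

include hcδ hδ hd hT₂ hDD hQm in
/-- **the Levi shift**: for a Siegel section `f ∈ I_v(s, χ_v)`,
`∫ f(w_Δ u h) dνN = χ_s(m₀) · ∫ f(φ(w_Δ^J) u h) dνN` (`m₀ = w_Δ φ(w_Δ^J) ∈ P_Δ(F_v)`, ★ `isSiegelDelta_weylDelta_mul_frameConj_weylSiegel`).
[cite: HarrisKudlaSweet1996, §1 (1.12)] [cite: Casselman1980, §3] -/
theorem localIntertwining_eq_mul_integral_frameConj [MeasurableSpace (unipDeltaLocal F E c v 2 (JD := J₂D))] (νN : Measure (unipDeltaLocal F E c v 2 (JD := J₂D)))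
    (χv : ∀ w : PlacesOver E v, (w.1.adicCompletion E)ˣ →* ℂˣ) (s : ℂ) {f : UnitaryGroup.localPi E c (2 + 2) J₂D v → ℂ}
    (hf : IsLocalSiegelSection F E c hcδ hδ hd v 2 hT₂ hJ₂D χv s f) (h : UnitaryGroup.localPi E c (2 + 2) J₂D v) :
    localIntertwining F E c v 2 hJ₂D νN f h =
      localSiegelCharacter F E c v 2 χv s (weylDelta F E c v 2 hJ₂D (T₀ := T₂) * FrameTransport.frameConj F E c v (2 + 2) hJ₂D (antidiagonal_over_eq_map F E 2) Q hQ (toLocalFour F E c v (weylSiegel (UnitaryGroup.LocalRing E v) (UnitaryGroup.conjLocal E c v)))) *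
        ∫ u, f (FrameTransport.frameConj F E c v (2 + 2) hJ₂D (antidiagonal_over_eq_map F E 2) Q hQ (toLocalFour F E c v (weylSiegel (UnitaryGroup.LocalRing E v) (UnitaryGroup.conjLocal E c v))) * (u : UnitaryGroup.localPi E c (2 + 2) J₂D v) * h) ∂νN := by
  unfold localIntertwining
  rw [← integral_const_mul]
  refine integral_congr_ae (Filter.Eventually.of_forall fun u => ?_)
  show f (weylDelta F E c v 2 hJ₂D * (u : UnitaryGroup.localPi E c (2 + 2) J₂D v) * h) = _
  conv_lhs => rw [weylDelta_eq_mul_frameConj_weylSiegel F E c v hJ₂D Q hQ]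
  rw [mul_assoc, mul_assoc, hf _ (isSiegelDelta_weylDelta_mul_frameConj_weylSiegel F E c hcδ hδ hd v hT₂ hJ₂D D Dinv hDD Q hQm hQ), ← mul_assoc]

/-! ## §2 The Haar measure of `N_Δ(F_v)` in coordinates -/

section Measure

variable [MeasurableSpace (v.adicCompletion F)] [BorelSpace (v.adicCompletion F)] [SecondCountableTopology (v.adicCompletion F)]
  [MeasurableSpace (UnitaryGroup.LocalRing E v)] [BorelSpace (UnitaryGroup.LocalRing E v)] [SecondCountableTopology (UnitaryGroup.LocalRing E v)]
  [MeasurableSpace (unipDeltaLocal F E c v 2 (JD := J₂D))] [BorelSpace (unipDeltaLocal F E c v 2 (JD := J₂D))]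

omit [Algebra.IsQuadraticExtension F E] in
/-- **`νN = c • map e (μ_F ⊗ μ_R ⊗ μ_F)` for some `c > 0`**, for any additive-to-multiplicative homeomorphism `e` onto `N_Δ(F_v)`
(★ B1b-2b `isAddHaarMeasure_map_symm` + Haar uniqueness `Measure.isAddLeftInvariant_eq_smul`; `c` = the Haar scalar factor). [cite: Weil1965, §37] -/
theorem exists_measure_eq_smul_map (e : (v.adicCompletion F × UnitaryGroup.LocalRing E v × v.adicCompletion F) ≃ₜ unipDeltaLocal F E c v 2 (JD := J₂D))
    (hmul : ∀ p p', e (p + p') = e p * e p') (νN : Measure (unipDeltaLocal F E c v 2 (JD := J₂D))) [νN.IsHaarMeasure]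
    (μF : Measure (v.adicCompletion F)) [μF.IsAddHaarMeasure] (μR : Measure (UnitaryGroup.LocalRing E v)) [μR.IsAddHaarMeasure] :
    ∃ cN : ℝ≥0, 0 < cN ∧ νN = (cN : ℝ≥0∞) • Measure.map e.toMeasurableEquiv (μF.prod (μR.prod μF)) := by
  haveI := isAddHaarMeasure_map_symm F E c v (J₂D := J₂D) e hmul νN
  haveI : (μR.prod μF).IsAddHaarMeasure := Measure.prod.instIsAddHaarMeasure μR μF
  haveI : (μF.prod (μR.prod μF)).IsAddHaarMeasure := Measure.prod.instIsAddHaarMeasure μF (μR.prod μF)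
  have hsmul := Measure.isAddLeftInvariant_eq_smul (Measure.map e.symm νN) (μF.prod (μR.prod μF))
  have hback : Measure.map e (Measure.map e.symm νN) = νN := by
    rw [Measure.map_map e.continuous.measurable e.symm.continuous.measurable, Homeomorph.self_comp_symm, Measure.map_id]
  refine ⟨(Measure.map e.symm νN).addHaarScalarFactor (μF.prod (μR.prod μF)), Measure.addHaarScalarFactor_pos_of_isAddHaarMeasure _ _, ?_⟩
  calc νN = Measure.map e (Measure.map e.symm νN) := hback.symm
    _ = Measure.map e ((Measure.map e.symm νN).addHaarScalarFactor (μF.prod (μR.prod μF)) • μF.prod (μR.prod μF)) := by rw [← hsmul]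
    _ = (Measure.map e.symm νN).addHaarScalarFactor (μF.prod (μR.prod μF)) • Measure.map e (μF.prod (μR.prod μF)) := Measure.map_smul _ _ _
    _ = _ := by rw [ENNReal.smul_def]; rfl

/-! ## §3 The cocycle: the intertwining integral as an iterated rank-one integral -/

omit [MeasurableSpace (v.adicCompletion F)] [BorelSpace (v.adicCompletion F)] [SecondCountableTopology (v.adicCompletion F)]
  [MeasurableSpace (UnitaryGroup.LocalRing E v)] [BorelSpace (UnitaryGroup.LocalRing E v)] [SecondCountableTopology (UnitaryGroup.LocalRing E v)]
  [MeasurableSpace (unipDeltaLocal F E c v 2 (JD := J₂D))] [BorelSpace (unipDeltaLocal F E c v 2 (JD := J₂D))] in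
include hcδ hδ in
/-- **THE COCYCLE WORD IN `H_v`**: `φ(w_Δ^J) · e(x,z,y) = φ(w₂)φ(u_{2e₂}(ι_v(y)δ)) · φ(w₁)φ(u_{e₁−e₂}(z)) · φ(w₂)φ(u_{2e₂}(ι_v(x)δ))`
(★ `weylSiegel_mul_nSiegel` through `φ`). [cite: Casselman1980, §3 Thm. 3.1] -/
theorem frameConj_weylSiegel_mul_coord (x : v.adicCompletion F) (z : UnitaryGroup.LocalRing E v) (y : v.adicCompletion F) :
    FrameTransport.frameConj F E c v (2 + 2) hJ₂D (antidiagonal_over_eq_map F E 2) Q hQ (toLocalFour F E c v (weylSiegel (UnitaryGroup.LocalRing E v) (UnitaryGroup.conjLocal E c v))) *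
        FrameTransport.frameConj F E c v (2 + 2) hJ₂D (antidiagonal_over_eq_map F E 2) Q hQ
          (toLocalFour F E c v (nSiegel (UnitaryGroup.LocalRing E v) (UnitaryGroup.conjLocal E c v) (UnitaryGroup.conjLocal_conjLocal c v hcδ hδ)
            (UnitaryGroup.toLocalRing E v x * algebraMap E (UnitaryGroup.LocalRing E v) δ) z
            (UnitaryGroup.toLocalRing E v y * algebraMap E (UnitaryGroup.LocalRing E v) δ)
            (conjLocal_coord F E c hcδ v x) (conjLocal_coord F E c hcδ v y))) =
      FrameTransport.frameConj F E c v (2 + 2) hJ₂D (antidiagonal_over_eq_map F E 2) Q hQ (toLocalFour F E c v (weylTwo (UnitaryGroup.LocalRing E v) (UnitaryGroup.conjLocal E c v))) * FrameTransport.frameConj F E c v (2 + 2) hJ₂D (antidiagonal_over_eq_map F E 2) Q hQ (toLocalFour F E c v (uLongTwo (UnitaryGroup.LocalRing E v) (UnitaryGroup.conjLocal E c v) (UnitaryGroup.toLocalRing E v y * algebraMap E (UnitaryGroup.LocalRing E v) δ) (conjLocal_coord F E c hcδ v y))) *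
        (FrameTransport.frameConj F E c v (2 + 2) hJ₂D (antidiagonal_over_eq_map F E 2) Q hQ (toLocalFour F E c v (weylOne (UnitaryGroup.LocalRing E v) (UnitaryGroup.conjLocal E c v))) * FrameTransport.frameConj F E c v (2 + 2) hJ₂D (antidiagonal_over_eq_map F E 2) Q hQ (toLocalFour F E c v (uMinus (UnitaryGroup.LocalRing E v) (UnitaryGroup.conjLocal E c v) (UnitaryGroup.conjLocal_conjLocal c v hcδ hδ) z))) *
        (FrameTransport.frameConj F E c v (2 + 2) hJ₂D (antidiagonal_over_eq_map F E 2) Q hQ (toLocalFour F E c v (weylTwo (UnitaryGroup.LocalRing E v) (UnitaryGroup.conjLocal E c v))) * FrameTransport.frameConj F E c v (2 + 2) hJ₂D (antidiagonal_over_eq_map F E 2) Q hQ (toLocalFour F E c v (uLongTwo (UnitaryGroup.LocalRing E v) (UnitaryGroup.conjLocal E c v) (UnitaryGroup.toLocalRing E v x * algebraMap E (UnitaryGroup.LocalRing E v) δ) (conjLocal_coord F E c hcδ v x)))) := by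
  rw [← map_mul, ← map_mul, weylSiegel_mul_nSiegel]
  simp only [map_mul]

include hcδ hδ in
/-- **THE SIEGEL INTERTWINING INTEGRAL AS AN ITERATED RANK-ONE INTEGRAL** (`M = A₂ A₁ A₂` in `H_v`): for the coordinates `e` of ★ B1b-2b,
Haar `νN` on `N_Δ(F_v)`, additive Haar measures `μ_F`, `μ_R`, and `f`, `h` with the triple integrand integrable on `μ_F ⊗ μ_R ⊗ μ_F`,
`∫ f(φ(w_Δ^J) u h) dνN(u) = c · ∫_x ∫_z ∫_y f(φ(w₂)φ(u(ι(y)δ)) · (φ(w₁)φ(u₋(z)) · (φ(w₂)φ(u(ι(x)δ)) · h)))`.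
[cite: Casselman1980, §3 Thm. 3.1] [cite: HarrisKudlaSweet1996, §6 (6.14)] -/
theorem integral_frameConj_weylSiegel_eq_iterated (e : (v.adicCompletion F × UnitaryGroup.LocalRing E v × v.adicCompletion F) ≃ₜ unipDeltaLocal F E c v 2 (JD := J₂D))
    (he : ∀ b₁ z b₂, ((e (b₁, z, b₂) : unipDeltaLocal F E c v 2 (JD := J₂D)) : UnitaryGroup.localPi E c (2 + 2) J₂D v) =
      FrameTransport.frameConj F E c v (2 + 2) hJ₂D (antidiagonal_over_eq_map F E 2) Q hQ
          (toLocalFour F E c v (nSiegel (UnitaryGroup.LocalRing E v) (UnitaryGroup.conjLocal E c v) (UnitaryGroup.conjLocal_conjLocal c v hcδ hδ)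
            (UnitaryGroup.toLocalRing E v b₁ * algebraMap E (UnitaryGroup.LocalRing E v) δ) z
            (UnitaryGroup.toLocalRing E v b₂ * algebraMap E (UnitaryGroup.LocalRing E v) δ)
            (conjLocal_coord F E c hcδ v b₁) (conjLocal_coord F E c hcδ v b₂))))
    (νN : Measure (unipDeltaLocal F E c v 2 (JD := J₂D)))
    (μF : Measure (v.adicCompletion F)) (μR : Measure (UnitaryGroup.LocalRing E v)) [SFinite μF] [SFinite μR]
    (cN : ℝ≥0) (hν : νN = (cN : ℝ≥0∞) • Measure.map e.toMeasurableEquiv (μF.prod (μR.prod μF)))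
    (f : UnitaryGroup.localPi E c (2 + 2) J₂D v → ℂ) (h : UnitaryGroup.localPi E c (2 + 2) J₂D v)
    (hint : Integrable (fun p : v.adicCompletion F × (UnitaryGroup.LocalRing E v × v.adicCompletion F) =>
      f (FrameTransport.frameConj F E c v (2 + 2) hJ₂D (antidiagonal_over_eq_map F E 2) Q hQ (toLocalFour F E c v (weylTwo (UnitaryGroup.LocalRing E v) (UnitaryGroup.conjLocal E c v))) * FrameTransport.frameConj F E c v (2 + 2) hJ₂D (antidiagonal_over_eq_map F E 2) Q hQ (toLocalFour F E c v (uLongTwo (UnitaryGroup.LocalRing E v) (UnitaryGroup.conjLocal E c v) (UnitaryGroup.toLocalRing E v p.2.2 * algebraMap E (UnitaryGroup.LocalRing E v) δ) (conjLocal_coord F E c hcδ v p.2.2))) *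
          (FrameTransport.frameConj F E c v (2 + 2) hJ₂D (antidiagonal_over_eq_map F E 2) Q hQ (toLocalFour F E c v (weylOne (UnitaryGroup.LocalRing E v) (UnitaryGroup.conjLocal E c v))) * FrameTransport.frameConj F E c v (2 + 2) hJ₂D (antidiagonal_over_eq_map F E 2) Q hQ (toLocalFour F E c v (uMinus (UnitaryGroup.LocalRing E v) (UnitaryGroup.conjLocal E c v) (UnitaryGroup.conjLocal_conjLocal c v hcδ hδ) p.2.1)) *
            (FrameTransport.frameConj F E c v (2 + 2) hJ₂D (antidiagonal_over_eq_map F E 2) Q hQ (toLocalFour F E c v (weylTwo (UnitaryGroup.LocalRing E v) (UnitaryGroup.conjLocal E c v))) * FrameTransport.frameConj F E c v (2 + 2) hJ₂D (antidiagonal_over_eq_map F E 2) Q hQ (toLocalFour F E c v (uLongTwo (UnitaryGroup.LocalRing E v) (UnitaryGroup.conjLocal E c v) (UnitaryGroup.toLocalRing E v p.1 * algebraMap E (UnitaryGroup.LocalRing E v) δ) (conjLocal_coord F E c hcδ v p.1))) * h)))) (μF.prod (μR.prod μF))) :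
    ∫ u, f (FrameTransport.frameConj F E c v (2 + 2) hJ₂D (antidiagonal_over_eq_map F E 2) Q hQ (toLocalFour F E c v (weylSiegel (UnitaryGroup.LocalRing E v) (UnitaryGroup.conjLocal E c v))) * (u : UnitaryGroup.localPi E c (2 + 2) J₂D v) * h) ∂νN =
      ((cN : ℝ) : ℂ) *
        ∫ x, ∫ z, ∫ y, f (FrameTransport.frameConj F E c v (2 + 2) hJ₂D (antidiagonal_over_eq_map F E 2) Q hQ (toLocalFour F E c v (weylTwo (UnitaryGroup.LocalRing E v) (UnitaryGroup.conjLocal E c v))) * FrameTransport.frameConj F E c v (2 + 2) hJ₂D (antidiagonal_over_eq_map F E 2) Q hQ (toLocalFour F E c v (uLongTwo (UnitaryGroup.LocalRing E v) (UnitaryGroup.conjLocal E c v) (UnitaryGroup.toLocalRing E v y * algebraMap E (UnitaryGroup.LocalRing E v) δ) (conjLocal_coord F E c hcδ v y))) *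
          (FrameTransport.frameConj F E c v (2 + 2) hJ₂D (antidiagonal_over_eq_map F E 2) Q hQ (toLocalFour F E c v (weylOne (UnitaryGroup.LocalRing E v) (UnitaryGroup.conjLocal E c v))) * FrameTransport.frameConj F E c v (2 + 2) hJ₂D (antidiagonal_over_eq_map F E 2) Q hQ (toLocalFour F E c v (uMinus (UnitaryGroup.LocalRing E v) (UnitaryGroup.conjLocal E c v) (UnitaryGroup.conjLocal_conjLocal c v hcδ hδ) z)) *
            (FrameTransport.frameConj F E c v (2 + 2) hJ₂D (antidiagonal_over_eq_map F E 2) Q hQ (toLocalFour F E c v (weylTwo (UnitaryGroup.LocalRing E v) (UnitaryGroup.conjLocal E c v))) * FrameTransport.frameConj F E c v (2 + 2) hJ₂D (antidiagonal_over_eq_map F E 2) Q hQ (toLocalFour F E c v (uLongTwo (UnitaryGroup.LocalRing E v) (UnitaryGroup.conjLocal E c v) (UnitaryGroup.toLocalRing E v x * algebraMap E (UnitaryGroup.LocalRing E v) δ) (conjLocal_coord F E c hcδ v x))) * h))) ∂μF ∂μR ∂μF := by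
  have hword : ∀ (x : v.adicCompletion F) (z : UnitaryGroup.LocalRing E v) (y : v.adicCompletion F),
      FrameTransport.frameConj F E c v (2 + 2) hJ₂D (antidiagonal_over_eq_map F E 2) Q hQ (toLocalFour F E c v (weylSiegel (UnitaryGroup.LocalRing E v) (UnitaryGroup.conjLocal E c v))) * ((e.toMeasurableEquiv (x, (z, y)) : unipDeltaLocal F E c v 2 (JD := J₂D)) : UnitaryGroup.localPi E c (2 + 2) J₂D v) =
        FrameTransport.frameConj F E c v (2 + 2) hJ₂D (antidiagonal_over_eq_map F E 2) Q hQ (toLocalFour F E c v (weylTwo (UnitaryGroup.LocalRing E v) (UnitaryGroup.conjLocal E c v))) * FrameTransport.frameConj F E c v (2 + 2) hJ₂D (antidiagonal_over_eq_map F E 2) Q hQ (toLocalFour F E c v (uLongTwo (UnitaryGroup.LocalRing E v) (UnitaryGroup.conjLocal E c v) (UnitaryGroup.toLocalRing E v y * algebraMap E (UnitaryGroup.LocalRing E v) δ) (conjLocal_coord F E c hcδ v y))) *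
          (FrameTransport.frameConj F E c v (2 + 2) hJ₂D (antidiagonal_over_eq_map F E 2) Q hQ (toLocalFour F E c v (weylOne (UnitaryGroup.LocalRing E v) (UnitaryGroup.conjLocal E c v))) * FrameTransport.frameConj F E c v (2 + 2) hJ₂D (antidiagonal_over_eq_map F E 2) Q hQ (toLocalFour F E c v (uMinus (UnitaryGroup.LocalRing E v) (UnitaryGroup.conjLocal E c v) (UnitaryGroup.conjLocal_conjLocal c v hcδ hδ) z))) *
          (FrameTransport.frameConj F E c v (2 + 2) hJ₂D (antidiagonal_over_eq_map F E 2) Q hQ (toLocalFour F E c v (weylTwo (UnitaryGroup.LocalRing E v) (UnitaryGroup.conjLocal E c v))) * FrameTransport.frameConj F E c v (2 + 2) hJ₂D (antidiagonal_over_eq_map F E 2) Q hQ (toLocalFour F E c v (uLongTwo (UnitaryGroup.LocalRing E v) (UnitaryGroup.conjLocal E c v) (UnitaryGroup.toLocalRing E v x * algebraMap E (UnitaryGroup.LocalRing E v) δ) (conjLocal_coord F E c hcδ v x)))) := by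
    intro x z y
    rw [Homeomorph.toMeasurableEquiv_coe, he, frameConj_weylSiegel_mul_coord F E c hcδ hδ v hJ₂D Q hQ]
  have h := integral_comp_eq_iterated νN μF μR μF (fun u : unipDeltaLocal F E c v 2 (JD := J₂D) => (u : UnitaryGroup.localPi E c (2 + 2) J₂D v))
    e.toMeasurableEquiv _ _ _ _ _ hν hword f h hint
  rwa [ENNReal.coe_toReal] at h

include hcδ hδ in
/-- **… with integrability from the `|f|`-chain** (★ B4-abs `integral_comp_eq_iterated_of_chain`): the three hypotheses are the rank-one
integrabilities of `y ↦ ‖f(A y g)‖`, `z ↦ 𝒜|f|(B z g′)`, `x ↦ ℬ𝒜|f|(C x h)` (★ B2′ + ★ `K2LiuRankOneOperators`); conclusion = integrability on `N_Δ(F_v)`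
and the iterated formula. [cite: Casselman1980, §3 Thm. 3.1] [cite: Tate1950, §2.4] -/
theorem integral_frameConj_weylSiegel_eq_iterated_of_chain (e : (v.adicCompletion F × UnitaryGroup.LocalRing E v × v.adicCompletion F) ≃ₜ unipDeltaLocal F E c v 2 (JD := J₂D))
    (he : ∀ b₁ z b₂, ((e (b₁, z, b₂) : unipDeltaLocal F E c v 2 (JD := J₂D)) : UnitaryGroup.localPi E c (2 + 2) J₂D v) =
      FrameTransport.frameConj F E c v (2 + 2) hJ₂D (antidiagonal_over_eq_map F E 2) Q hQ
          (toLocalFour F E c v (nSiegel (UnitaryGroup.LocalRing E v) (UnitaryGroup.conjLocal E c v) (UnitaryGroup.conjLocal_conjLocal c v hcδ hδ)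
            (UnitaryGroup.toLocalRing E v b₁ * algebraMap E (UnitaryGroup.LocalRing E v) δ) z
            (UnitaryGroup.toLocalRing E v b₂ * algebraMap E (UnitaryGroup.LocalRing E v) δ)
            (conjLocal_coord F E c hcδ v b₁) (conjLocal_coord F E c hcδ v b₂))))
    (νN : Measure (unipDeltaLocal F E c v 2 (JD := J₂D)))
    (μF : Measure (v.adicCompletion F)) (μR : Measure (UnitaryGroup.LocalRing E v)) [SFinite μF] [SFinite μR]
    (cN : ℝ≥0) (hν : νN = (cN : ℝ≥0∞) • Measure.map e.toMeasurableEquiv (μF.prod (μR.prod μF)))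
    (f : UnitaryGroup.localPi E c (2 + 2) J₂D v → ℂ) (h : UnitaryGroup.localPi E c (2 + 2) J₂D v)
    (hmeas : AEStronglyMeasurable (fun p : v.adicCompletion F × (UnitaryGroup.LocalRing E v × v.adicCompletion F) =>
      f (FrameTransport.frameConj F E c v (2 + 2) hJ₂D (antidiagonal_over_eq_map F E 2) Q hQ (toLocalFour F E c v (weylTwo (UnitaryGroup.LocalRing E v) (UnitaryGroup.conjLocal E c v))) * FrameTransport.frameConj F E c v (2 + 2) hJ₂D (antidiagonal_over_eq_map F E 2) Q hQ (toLocalFour F E c v (uLongTwo (UnitaryGroup.LocalRing E v) (UnitaryGroup.conjLocal E c v) (UnitaryGroup.toLocalRing E v p.2.2 * algebraMap E (UnitaryGroup.LocalRing E v) δ) (conjLocal_coord F E c hcδ v p.2.2))) *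
          (FrameTransport.frameConj F E c v (2 + 2) hJ₂D (antidiagonal_over_eq_map F E 2) Q hQ (toLocalFour F E c v (weylOne (UnitaryGroup.LocalRing E v) (UnitaryGroup.conjLocal E c v))) * FrameTransport.frameConj F E c v (2 + 2) hJ₂D (antidiagonal_over_eq_map F E 2) Q hQ (toLocalFour F E c v (uMinus (UnitaryGroup.LocalRing E v) (UnitaryGroup.conjLocal E c v) (UnitaryGroup.conjLocal_conjLocal c v hcδ hδ) p.2.1)) *
            (FrameTransport.frameConj F E c v (2 + 2) hJ₂D (antidiagonal_over_eq_map F E 2) Q hQ (toLocalFour F E c v (weylTwo (UnitaryGroup.LocalRing E v) (UnitaryGroup.conjLocal E c v))) * FrameTransport.frameConj F E c v (2 + 2) hJ₂D (antidiagonal_over_eq_map F E 2) Q hQ (toLocalFour F E c v (uLongTwo (UnitaryGroup.LocalRing E v) (UnitaryGroup.conjLocal E c v) (UnitaryGroup.toLocalRing E v p.1 * algebraMap E (UnitaryGroup.LocalRing E v) δ) (conjLocal_coord F E c hcδ v p.1))) * h)))) (μF.prod (μR.prod μF)))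
    (hI1 : ∀ g : UnitaryGroup.localPi E c (2 + 2) J₂D v, Integrable (fun y : v.adicCompletion F => ‖f (FrameTransport.frameConj F E c v (2 + 2) hJ₂D (antidiagonal_over_eq_map F E 2) Q hQ (toLocalFour F E c v (weylTwo (UnitaryGroup.LocalRing E v) (UnitaryGroup.conjLocal E c v))) * FrameTransport.frameConj F E c v (2 + 2) hJ₂D (antidiagonal_over_eq_map F E 2) Q hQ (toLocalFour F E c v (uLongTwo (UnitaryGroup.LocalRing E v) (UnitaryGroup.conjLocal E c v) (UnitaryGroup.toLocalRing E v y * algebraMap E (UnitaryGroup.LocalRing E v) δ) (conjLocal_coord F E c hcδ v y))) * g)‖) μF)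
    (hI2 : ∀ g' : UnitaryGroup.localPi E c (2 + 2) J₂D v, Integrable (fun z : UnitaryGroup.LocalRing E v =>
      ∫ y, ‖f (FrameTransport.frameConj F E c v (2 + 2) hJ₂D (antidiagonal_over_eq_map F E 2) Q hQ (toLocalFour F E c v (weylTwo (UnitaryGroup.LocalRing E v) (UnitaryGroup.conjLocal E c v))) * FrameTransport.frameConj F E c v (2 + 2) hJ₂D (antidiagonal_over_eq_map F E 2) Q hQ (toLocalFour F E c v (uLongTwo (UnitaryGroup.LocalRing E v) (UnitaryGroup.conjLocal E c v) (UnitaryGroup.toLocalRing E v y * algebraMap E (UnitaryGroup.LocalRing E v) δ) (conjLocal_coord F E c hcδ v y))) * (FrameTransport.frameConj F E c v (2 + 2) hJ₂D (antidiagonal_over_eq_map F E 2) Q hQ (toLocalFour F E c v (weylOne (UnitaryGroup.LocalRing E v) (UnitaryGroup.conjLocal E c v))) * FrameTransport.frameConj F E c v (2 + 2) hJ₂D (antidiagonal_over_eq_map F E 2) Q hQ (toLocalFour F E c v (uMinus (UnitaryGroup.LocalRing E v) (UnitaryGroup.conjLocal E c v) (UnitaryGroup.conjLocal_conjLocal c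 v hcδ hδ) z)) * g'))‖ ∂μF) μR)
    (hI3 : Integrable (fun x : v.adicCompletion F => ∫ z, ∫ y, ‖f (FrameTransport.frameConj F E c v (2 + 2) hJ₂D (antidiagonal_over_eq_map F E 2) Q hQ (toLocalFour F E c v (weylTwo (UnitaryGroup.LocalRing E v) (UnitaryGroup.conjLocal E c v))) * FrameTransport.frameConj F E c v (2 + 2) hJ₂D (antidiagonal_over_eq_map F E 2) Q hQ (toLocalFour F E c v (uLongTwo (UnitaryGroup.LocalRing E v) (UnitaryGroup.conjLocal E c v) (UnitaryGroup.toLocalRing E v y * algebraMap E (UnitaryGroup.LocalRing E v) δ) (conjLocal_coord F E c hcδ v y))) *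
      (FrameTransport.frameConj F E c v (2 + 2) hJ₂D (antidiagonal_over_eq_map F E 2) Q hQ (toLocalFour F E c v (weylOne (UnitaryGroup.LocalRing E v) (UnitaryGroup.conjLocal E c v))) * FrameTransport.frameConj F E c v (2 + 2) hJ₂D (antidiagonal_over_eq_map F E 2) Q hQ (toLocalFour F E c v (uMinus (UnitaryGroup.LocalRing E v) (UnitaryGroup.conjLocal E c v) (UnitaryGroup.conjLocal_conjLocal c v hcδ hδ) z)) * (FrameTransport.frameConj F E c v (2 + 2) hJ₂D (antidiagonal_over_eq_map F E 2) Q hQ (toLocalFour F E c v (weylTwo (UnitaryGroup.LocalRing E v) (UnitaryGroup.conjLocal E c v))) * FrameTransport.frameConj F E c v (2 + 2) hJ₂D (antidiagonal_over_eq_map F E 2) Q hQ (toLocalFour F E c v (uLongTwo (UnitaryGroup.LocalRing E v) (UnitaryGroup.conjLocal E c v) (UnitaryGroup.toLocalRing E v x * algebraMap E (UnitaryGroup.LocalRing E v) δ) (conjLocal_coord F E c hcδ v x))) * h)))‖ ∂μF ∂μR) μF) :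
    Integrable (fun u : unipDeltaLocal F E c v 2 (JD := J₂D) => f (FrameTransport.frameConj F E c v (2 + 2) hJ₂D (antidiagonal_over_eq_map F E 2) Q hQ (toLocalFour F E c v (weylSiegel (UnitaryGroup.LocalRing E v) (UnitaryGroup.conjLocal E c v))) * (u : UnitaryGroup.localPi E c (2 + 2) J₂D v) * h)) νN ∧
      ∫ u, f (FrameTransport.frameConj F E c v (2 + 2) hJ₂D (antidiagonal_over_eq_map F E 2) Q hQ (toLocalFour F E c v (weylSiegel (UnitaryGroup.LocalRing E v) (UnitaryGroup.conjLocal E c v))) * (u : UnitaryGroup.localPi E c (2 + 2) J₂D v) * h) ∂νN =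
        ((cN : ℝ) : ℂ) *
          ∫ x, ∫ z, ∫ y, f (FrameTransport.frameConj F E c v (2 + 2) hJ₂D (antidiagonal_over_eq_map F E 2) Q hQ (toLocalFour F E c v (weylTwo (UnitaryGroup.LocalRing E v) (UnitaryGroup.conjLocal E c v))) * FrameTransport.frameConj F E c v (2 + 2) hJ₂D (antidiagonal_over_eq_map F E 2) Q hQ (toLocalFour F E c v (uLongTwo (UnitaryGroup.LocalRing E v) (UnitaryGroup.conjLocal E c v) (UnitaryGroup.toLocalRing E v y * algebraMap E (UnitaryGroup.LocalRing E v) δ) (conjLocal_coord F E c hcδ v y))) *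
          (FrameTransport.frameConj F E c v (2 + 2) hJ₂D (antidiagonal_over_eq_map F E 2) Q hQ (toLocalFour F E c v (weylOne (UnitaryGroup.LocalRing E v) (UnitaryGroup.conjLocal E c v))) * FrameTransport.frameConj F E c v (2 + 2) hJ₂D (antidiagonal_over_eq_map F E 2) Q hQ (toLocalFour F E c v (uMinus (UnitaryGroup.LocalRing E v) (UnitaryGroup.conjLocal E c v) (UnitaryGroup.conjLocal_conjLocal c v hcδ hδ) z)) *
            (FrameTransport.frameConj F E c v (2 + 2) hJ₂D (antidiagonal_over_eq_map F E 2) Q hQ (toLocalFour F E c v (weylTwo (UnitaryGroup.LocalRing E v) (UnitaryGroup.conjLocal E c v))) * FrameTransport.frameConj F E c v (2 + 2) hJ₂D (antidiagonal_over_eq_map F E 2) Q hQ (toLocalFour F E c v (uLongTwo (UnitaryGroup.LocalRing E v) (UnitaryGroup.conjLocal E c v) (UnitaryGroup.toLocalRing E v x * algebraMap E (UnitaryGroup.LocalRing E v) δ) (conjLocal_coord F E c hcδ v x))) * h))) ∂μF ∂μR ∂μF := by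
  have hword : ∀ (x : v.adicCompletion F) (z : UnitaryGroup.LocalRing E v) (y : v.adicCompletion F),
      FrameTransport.frameConj F E c v (2 + 2) hJ₂D (antidiagonal_over_eq_map F E 2) Q hQ (toLocalFour F E c v (weylSiegel (UnitaryGroup.LocalRing E v) (UnitaryGroup.conjLocal E c v))) * ((e.toMeasurableEquiv (x, (z, y)) : unipDeltaLocal F E c v 2 (JD := J₂D)) : UnitaryGroup.localPi E c (2 + 2) J₂D v) =
        FrameTransport.frameConj F E c v (2 + 2) hJ₂D (antidiagonal_over_eq_map F E 2) Q hQ (toLocalFour F E c v (weylTwo (UnitaryGroup.LocalRing E v) (UnitaryGroup.conjLocal E c v))) * FrameTransport.frameConj F E c v (2 + 2) hJ₂D (antidiagonal_over_eq_map F E 2) Q hQ (toLocalFour F E c v (uLongTwo (UnitaryGroup.LocalRing E v) (UnitaryGroup.conjLocal E c v) (UnitaryGroup.toLocalRing E v y * algebraMap E (UnitaryGroup.LocalRing E v) δ) (conjLocal_coord F E c hcδ v y))) *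
          (FrameTransport.frameConj F E c v (2 + 2) hJ₂D (antidiagonal_over_eq_map F E 2) Q hQ (toLocalFour F E c v (weylOne (UnitaryGroup.LocalRing E v) (UnitaryGroup.conjLocal E c v))) * FrameTransport.frameConj F E c v (2 + 2) hJ₂D (antidiagonal_over_eq_map F E 2) Q hQ (toLocalFour F E c v (uMinus (UnitaryGroup.LocalRing E v) (UnitaryGroup.conjLocal E c v) (UnitaryGroup.conjLocal_conjLocal c v hcδ hδ) z))) *
          (FrameTransport.frameConj F E c v (2 + 2) hJ₂D (antidiagonal_over_eq_map F E 2) Q hQ (toLocalFour F E c v (weylTwo (UnitaryGroup.LocalRing E v) (UnitaryGroup.conjLocal E c v))) * FrameTransport.frameConj F E c v (2 + 2) hJ₂D (antidiagonal_over_eq_map F E 2) Q hQ (toLocalFour F E c v (uLongTwo (UnitaryGroup.LocalRing E v) (UnitaryGroup.conjLocal E c v) (UnitaryGroup.toLocalRing E v x * algebraMap E (UnitaryGroup.LocalRing E v) δ) (conjLocal_coord F E c hcδ v x)))) := by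
    intro x z y
    rw [Homeomorph.toMeasurableEquiv_coe, he, frameConj_weylSiegel_mul_coord F E c hcδ hδ v hJ₂D Q hQ]
  have h := integral_comp_eq_iterated_of_chain νN μF μR μF (fun u : unipDeltaLocal F E c v 2 (JD := J₂D) => (u : UnitaryGroup.localPi E c (2 + 2) J₂D v))
    e.toMeasurableEquiv _ _ _ _ _ hν ENNReal.coe_ne_top hword f h hmeas hI1 hI2 hI3
  rwa [ENNReal.coe_toReal] at h

end Measure

end Summit.HodgeConjecture.HodgeConjecture.Cruxes.HLiu418.K2LiuSiegelIntertwiningCocycle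

end
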